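import Mathlib
import HarnessLib
import Literature.Analysis.Calculus.MixedPartialBound
import Summits.HubbardSuperconductivity.HubbardSuperconductivity.Theorems.KLProgrammeC4aPPKernelTrueJetsJoint
import Summits.HubbardSuperconductivity.HubbardSuperconductivity.Theorems.KLProgrammeC4aPPKernelSplitProfileJets

/-!
# Route `KLProgramme` — crux C4a, S3 brick (B4) «(B4)-UMK1», «PIECES ALL ORDERS» part 3: the one-partition pieces `A_s = P·κ(r)` and `M_s = P·(1−κ(r)−κ(1−r))`
# have `u`-jets AT EVERY ORDER in the law currency — envelopes `(max |e| |u|)⁻¹^(j+1)` / `(max lo |u|)⁻¹^(j+1)`, `C^k`, joint continuity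

Cell `gate-hubbard-kl`, seat hubbard-kl-k3c3-p1 (g20; row «δμ-flow with klAngularMean constant piece»).  Assembles «(U1)-K-JETS-ALL-ORDERS» (`…C4aPPKernelTrueJets{Core,AllOrders,Joint}`:
the kernel `P`) with «PIECES ALL ORDERS» parts 1–2 (`…C4aPPKernelSmoothScaleJets`, `…C4aPPKernelSplitProfileJets`: the partition factors) by Leibniz; the order-`k` analogue of this
seat's g17/g19 rows `ppFarKernelS_rows`, `ppMidKernelS_rows`, `…_firstOrderRows` (k3c3-p3 g39 word l.13570 «same for the `A_s, M_s`/bumped Leibniz rows», pen (R559)).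
* §1 two generic tools: **`abs_iteratedDeriv_mul_le_of_rows`** (kernel rows `A·ρ^{−(i+1)}` × factor rows `B·ρ^{−j}` ⟹ product rows `2ᵏ·A·B·ρ^{−(k+1)}` — also the shape of the
  bump transfer `χ(u)·K` at every order) and **`continuous_iteratedDeriv_slice₂`** (the `u`-jets of a jointly `C^∞` function of `(e,u)` are jointly continuous —
  `Literature…MixedPartialBound.iteratedFDeriv_slice_right_eq` + evaluation);
* §2 joint smoothness of the factors (`contDiff_comp_ppSmoothRatio₂`, `contDiff_midFactor₂`) and the factor rows in a radius `ρ` with `1/(m̃ₑ+m̃ᵤ) ≤ 1/ρ`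
  (`comp_ppSmoothRatio_rows_of_radius`, `midFactor_rows_of_radius`; constant `B_κ = k!·X_κ·((k!)²·4/t₁)ᵏ`, resp. `1 + 2B_κ`);
* §3 **`ppFarKernelS_jets_le_of_radius`**, **`ppMidKernelS_jets_le_of_radius`** — `∀ j ≤ k`, `|∂ᵤʲ A_s(e,·)(u)| ≤ 2ᵏ·A·B_κ·ρ^{−(j+1)}` whenever the kernel has rows
  `A·ρ^{−(i+1)}` (`i ≤ k`) at `(e,u)` and `1/(m̃ₑ+m̃ᵤ) ≤ 1/ρ`;
* §4 THE ROWS IN THE LAW CURRENCY: **`ppFarKernelS_orderRows`**, **`ppMidKernelS_orderRows`** — strip `0 < lo ≤ Λ`, box `hi ≤ K·Λ`, `1 ≤ K`,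
  `C ≥ 2ᵏ·(k+1)!·2^{2k+2}·(1+X)·K^{k+1}·B` (`B = B_κ`, resp. `1 + 2B_κ`): `C^k` in `u` ∧ `∀ j ≤ k` joint continuity of `∂ᵤʲ(piece/C)` ∧
  `|∂ᵤʲ(piece/C)(e,u)| ≤ (max |e| |u|)⁻¹^(j+1)` on the box (`e ≠ 0`) ∧ `≤ (max lo |u|)⁻¹^(j+1)` on the strip — for an ABSTRACT smooth profile (`κ = 1` below `t₁/2`,
  `= 0` above `t₁`, `0 < t₁ ≤ 2/3`, jets `≤ X_κ` to order `k`); `ppSplitProfile t₁` discharges the profile hypotheses by `ppSplitProfile_hyps` / `ppSplitProfile_jetTable`.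
Not here: the swap piece (ruled `U = 2U_A + U_M`, (R529)(A)), flatness/comparability rows of orders `≥ 2` (law-specific, after the pen's architecture word (γ)).
Pure real analysis on landed objects; nothing asserts (C), any engine row, K3, the window or superconductivity.
References: BGM 2006 §2.4 (2.36) [cite: BenfattoGiulianiMastropietro2006]; FST II CPAM 51 (1998) §3 [cite: FeldmanSalmhoferTrubowitz1998].
-/

noncomputable section

namespace Summit.HubbardSuperconductivity.HubbardSuperconductivity.Theorems.C4a

set_option linter.dupNamespace false -- summit = problem name (single-conjunct summit), D-0017

open Real Filter Set Finset
open scoped Topology Nat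
open Literature.MathematicalPhysics.QuantumLattice Literature.Analysis.SpecialFunctions Literature.Analysis.Calculus

/-! ## §1 Two generic tools -/

/-- **Product rows**: if `|∂ⁱf(u)| ≤ A·ρ^{−(i+1)}` (`i ≤ k`) and `|∂ʲg(u)| ≤ B·ρ^{−j}` (`j ≤ k`), then `|∂ᵏ(fg)(u)| ≤ 2ᵏ·A·B·ρ^{−(k+1)}`. [folklore] -/
theorem abs_iteratedDeriv_mul_le_of_rows {f g : ℝ → ℝ} {k : ℕ} (hf : ContDiff ℝ k f) (hg : ContDiff ℝ k g) (u : ℝ) {ρ A B : ℝ} (hρ : 0 < ρ)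
    (hA : ∀ i ≤ k, |iteratedDeriv i f u| ≤ A * (1 / ρ) ^ (i + 1)) (hB : ∀ j ≤ k, |iteratedDeriv j g u| ≤ B * (1 / ρ) ^ j) :
    |iteratedDeriv k (fun v : ℝ => f v * g v) u| ≤ 2 ^ k * A * B * (1 / ρ) ^ (k + 1) := by
  have h := norm_iteratedDeriv_mul_le_of_geometric hf hg u (A := A * (1 / ρ)) (B := B) (ρ := 1 / ρ) (by positivity)
    (fun i hi => by rw [Real.norm_eq_abs]; refine (hA i hi).trans (le_of_eq ?_); ring) (fun i hi => by rw [Real.norm_eq_abs]; exact hB i hi)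
  rw [Real.norm_eq_abs] at h
  refine h.trans (le_of_eq ?_)
  ring

/-- **The `u`-jets of a jointly smooth function of `(e,u)` are jointly continuous**:
`ContDiff ℝ ∞ g ⟹ Continuous fun p => iteratedDeriv m (fun v => g (p.1, v)) p.2`. [folklore] -/
theorem continuous_iteratedDeriv_slice₂ {g : ℝ × ℝ → ℝ} (hg : ContDiff ℝ (⊤ : ℕ∞) g) (m : ℕ) :
    Continuous fun p : ℝ × ℝ => iteratedDeriv m (fun v : ℝ => g (p.1, v)) p.2 := by
  have hm : ((m : ℕ∞) : WithTop ℕ∞) ≤ ((⊤ : ℕ∞) : WithTop ℕ∞) := by exact_mod_cast le_top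
  have key : ∀ p : ℝ × ℝ, iteratedDeriv m (fun v : ℝ => g (p.1, v)) p.2 =
      (iteratedFDeriv ℝ m g (p.1, p.2)) (fun _ => ContinuousLinearMap.inr ℝ ℝ ℝ 1) := by
    intro p
    rw [iteratedDeriv_eq_iteratedFDeriv, iteratedFDeriv_slice_right_eq isOpen_univ (hg.contDiffOn) (mem_univ p.1) hm p.2]
    rfl
  have hfun : (fun p : ℝ × ℝ => iteratedDeriv m (fun v : ℝ => g (p.1, v)) p.2) =
      fun p : ℝ × ℝ => (iteratedFDeriv ℝ m g p) (fun _ => ContinuousLinearMap.inr ℝ ℝ ℝ 1) := by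
    funext p; rw [key p]
  rw [hfun]
  exact (continuous_eval_const _).comp (hg.continuous_iteratedFDeriv hm)

/-! ## §2 The partition factors: joint smoothness and rows in a radius -/

/-- `(e,u) ↦ r(e,u)` is jointly `C^∞` (`0 < lo`). [folklore] -/
theorem contDiff_ppSmoothRatio₂ {lo : ℝ} (hlo : 0 < lo) {N : ℕ∞} : ContDiff ℝ N fun p : ℝ × ℝ => ppSmoothRatio lo p.1 p.2 := by
  unfold ppSmoothRatio
  refine ContDiff.div ((contDiff_ppSmoothScale hlo).comp contDiff_fst)
    (((contDiff_ppSmoothScale hlo).comp contDiff_fst).add ((contDiff_ppSmoothScale hlo).comp contDiff_snd)) fun p => ?_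
  have h1 := ppSmoothScale_pos hlo p.1
  have h2 := ppSmoothScale_pos hlo p.2
  exact ne_of_gt (by simpa using add_pos h1 h2)

/-- `(e,u) ↦ κ(r(e,u))` is jointly `C^∞`. [folklore] -/
theorem contDiff_comp_ppSmoothRatio₂ {lo : ℝ} (hlo : 0 < lo) {κ : ℝ → ℝ} (hκ : ContDiff ℝ (⊤ : ℕ∞) κ) :
    ContDiff ℝ (⊤ : ℕ∞) fun p : ℝ × ℝ => κ (ppSmoothRatio lo p.1 p.2) :=
  hκ.comp (contDiff_ppSmoothRatio₂ hlo)

/-- `(e,u) ↦ 1 − κ(r) − κ(1−r)` is jointly `C^∞`. [folklore] -/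
theorem contDiff_midFactor₂ {lo : ℝ} (hlo : 0 < lo) {κ : ℝ → ℝ} (hκ : ContDiff ℝ (⊤ : ℕ∞) κ) :
    ContDiff ℝ (⊤ : ℕ∞) fun p : ℝ × ℝ => 1 - κ (ppSmoothRatio lo p.1 p.2) - κ (1 - ppSmoothRatio lo p.1 p.2) :=
  (contDiff_const.sub (hκ.comp (contDiff_ppSmoothRatio₂ hlo))).sub (hκ.comp (contDiff_const.sub (contDiff_ppSmoothRatio₂ hlo)))

/-- The order-uniform factor constant dominates each order: `j!·X_κ·((j!)²·4/t₁)ʲ ≤ k!·X_κ·((k!)²·4/t₁)ᵏ` for `j ≤ k` (`0 < t₁ ≤ 2/3`, `0 ≤ X_κ`). [folklore] -/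
theorem factorConst_mono {j k : ℕ} (hj : j ≤ k) {t₁ Xκ : ℝ} (ht₀ : 0 < t₁) (ht23 : t₁ ≤ 2 / 3) (hX0 : 0 ≤ Xκ) :
    (j ! : ℝ) * Xκ * (((j ! : ℝ)) ^ 2 * (4 / t₁)) ^ j ≤ k ! * Xκ * (((k ! : ℝ)) ^ 2 * (4 / t₁)) ^ k := by
  have hf : ((j ! : ℝ)) ≤ k ! := by exact_mod_cast Nat.factorial_le hj
  have h4 : (6 : ℝ) ≤ 4 / t₁ := by rw [le_div_iff₀ ht₀]; linarith
  have hk1 : (1 : ℝ) ≤ k ! := by exact_mod_cast Nat.succ_le_of_lt (Nat.factorial_pos k)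
  have hbase : (1 : ℝ) ≤ ((k ! : ℝ)) ^ 2 * (4 / t₁) := by nlinarith
  have hpow : (((j ! : ℝ)) ^ 2 * (4 / t₁)) ^ j ≤ (((k ! : ℝ)) ^ 2 * (4 / t₁)) ^ k :=
    (pow_le_pow_left₀ (by positivity) (by gcongr) j).trans (pow_le_pow_right₀ hbase hj)
  gcongr

/-- **Rows of `κ(r(e,·))` in a radius**: `1/(m̃ₑ+m̃ᵤ) ≤ 1/ρ ⟹ ∀ j ≤ k, |∂ᵤʲκ(r(e,·))(u)| ≤ B_κ·(1/ρ)ʲ`, `B_κ = k!·X_κ·((k!)²·4/t₁)ᵏ`.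
[cite: BenfattoGiulianiMastropietro2006, §2.4 (2.36)] -/
theorem comp_ppSmoothRatio_rows_of_radius {lo : ℝ} (hlo : 0 < lo) {κ : ℝ → ℝ} (hκ : ContDiff ℝ (⊤ : ℕ∞) κ) {t₁ : ℝ} (ht₀ : 0 < t₁)
    (ht23 : t₁ ≤ 2 / 3) (h1 : ∀ t, t ≤ t₁ / 2 → κ t = 1) (h0 : ∀ t, t₁ ≤ t → κ t = 0) {k : ℕ} {Xκ : ℝ}
    (hXκ : ∀ i ≤ k, ∀ t : ℝ, |iteratedDeriv i κ t| ≤ Xκ) {e u ρ : ℝ} (hρ2 : 1 / (ppSmoothScale lo e + ppSmoothScale lo u) ≤ 1 / ρ) :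
    ∀ j ≤ k, |iteratedDeriv j (fun v : ℝ => κ (ppSmoothRatio lo e v)) u| ≤ (k ! * Xκ * (((k ! : ℝ)) ^ 2 * (4 / t₁)) ^ k) * (1 / ρ) ^ j := by
  intro j hj
  have ha := ppSmoothScale_pos hlo e
  have hs := ppSmoothScale_pos hlo u
  have hX0 : 0 ≤ Xκ := (abs_nonneg _).trans (hXκ 0 (Nat.zero_le _) 0)
  have h := abs_iteratedDeriv_comp_ppSmoothRatio_le hlo hκ ht₀ ht23 h1 h0 (n := j) (fun i hi t => hXκ i (hi.trans hj) t) e u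
  refine h.trans ?_
  rw [mul_pow (((j ! : ℝ)) ^ 2 * (4 / t₁))]
  calc (j ! : ℝ) * Xκ * ((((j ! : ℝ)) ^ 2 * (4 / t₁)) ^ j * (1 / (ppSmoothScale lo e + ppSmoothScale lo u)) ^ j)
      = ((j ! : ℝ) * Xκ * (((j ! : ℝ)) ^ 2 * (4 / t₁)) ^ j) * (1 / (ppSmoothScale lo e + ppSmoothScale lo u)) ^ j := by ring
    _ ≤ (k ! * Xκ * (((k ! : ℝ)) ^ 2 * (4 / t₁)) ^ k) * (1 / ρ) ^ j :=
        mul_le_mul (factorConst_mono hj ht₀ ht23 hX0) (pow_le_pow_left₀ (by positivity) hρ2 j) (by positivity) (by positivity)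

/-- **Rows of the comparable-levels factor in a radius**: `∀ j ≤ k, |∂ᵤʲ(1 − κ(r) − κ(1−r))(u)| ≤ (1 + 2B_κ)·(1/ρ)ʲ`. [cite: BenfattoGiulianiMastropietro2006, §2.4 (2.36)] -/
theorem midFactor_rows_of_radius {lo : ℝ} (hlo : 0 < lo) {κ : ℝ → ℝ} (hκ : ContDiff ℝ (⊤ : ℕ∞) κ) {t₁ : ℝ} (ht₀ : 0 < t₁)
    (ht23 : t₁ ≤ 2 / 3) (h1 : ∀ t, t ≤ t₁ / 2 → κ t = 1) (h0 : ∀ t, t₁ ≤ t → κ t = 0) {k : ℕ} {Xκ : ℝ}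
    (hXκ : ∀ i ≤ k, ∀ t : ℝ, |iteratedDeriv i κ t| ≤ Xκ) {e u ρ : ℝ} (hρ : 0 < ρ) (hρ2 : 1 / (ppSmoothScale lo e + ppSmoothScale lo u) ≤ 1 / ρ) :
    ∀ j ≤ k, |iteratedDeriv j (fun v : ℝ => 1 - κ (ppSmoothRatio lo e v) - κ (1 - ppSmoothRatio lo e v)) u| ≤
      (1 + 2 * (k ! * Xκ * (((k ! : ℝ)) ^ 2 * (4 / t₁)) ^ k)) * (1 / ρ) ^ j := by
  intro j hj
  have ha := ppSmoothScale_pos hlo e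
  have hs := ppSmoothScale_pos hlo u
  have hX0 : 0 ≤ Xκ := (abs_nonneg _).trans (hXκ 0 (Nat.zero_le _) 0)
  have h := abs_iteratedDeriv_midFactor_le hlo hκ ht₀ ht23 h1 h0 (n := j) (fun i hi t => hXκ i (hi.trans hj) t) e u
  refine h.trans ?_
  have hinner : (j ! : ℝ) * Xκ * (((j ! : ℝ)) ^ 2 * (4 / t₁) * (1 / (ppSmoothScale lo e + ppSmoothScale lo u))) ^ j ≤
      (k ! * Xκ * (((k ! : ℝ)) ^ 2 * (4 / t₁)) ^ k) * (1 / ρ) ^ j := by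
    rw [mul_pow (((j ! : ℝ)) ^ 2 * (4 / t₁))]
    calc (j ! : ℝ) * Xκ * ((((j ! : ℝ)) ^ 2 * (4 / t₁)) ^ j * (1 / (ppSmoothScale lo e + ppSmoothScale lo u)) ^ j)
        = ((j ! : ℝ) * Xκ * (((j ! : ℝ)) ^ 2 * (4 / t₁)) ^ j) * (1 / (ppSmoothScale lo e + ppSmoothScale lo u)) ^ j := by ring
      _ ≤ (k ! * Xκ * (((k ! : ℝ)) ^ 2 * (4 / t₁)) ^ k) * (1 / ρ) ^ j :=
          mul_le_mul (factorConst_mono hj ht₀ ht23 hX0) (pow_le_pow_left₀ (by positivity) hρ2 j) (by positivity) (by positivity)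
  have hB0 : 0 ≤ (k ! * Xκ * (((k ! : ℝ)) ^ 2 * (4 / t₁)) ^ k) := by positivity
  have hp0 : 0 ≤ (1 / ρ) ^ j := by positivity
  rcases Nat.eq_zero_or_pos j with rfl | hjpos
  · simp only [if_true, pow_zero, mul_one] at hinner ⊢
    linarith
  · rw [if_neg (by omega), zero_add]
    nlinarith

/-! ## §3 The pieces in a radius -/

/-- `u ↦ A_s(e,u)` is `C^∞`. [folklore] -/
theorem contDiff_ppFarKernelS_u' {β Λ : ℝ} (hβ : 0 < β) (hΛ : 0 < Λ) {lo : ℝ} (hlo : 0 < lo) {κ : ℝ → ℝ} (hκ : ContDiff ℝ (⊤ : ℕ∞) κ) (e : ℝ) {N : ℕ∞} :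
    ContDiff ℝ N (fun v : ℝ => ppFarKernelS β Λ κ lo e v) := by
  unfold ppFarKernelS
  exact (contDiff_ppTrueKernel_u hβ hΛ e).mul ((hκ.of_le (by exact_mod_cast le_top)).comp (contDiff_ppSmoothRatio hlo e))

/-- `u ↦ M_s(e,u)` is `C^∞`. [folklore] -/
theorem contDiff_ppMidKernelS_u' {β Λ : ℝ} (hβ : 0 < β) (hΛ : 0 < Λ) {lo : ℝ} (hlo : 0 < lo) {κ : ℝ → ℝ} (hκ : ContDiff ℝ (⊤ : ℕ∞) κ) (e : ℝ) {N : ℕ∞} :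
    ContDiff ℝ N (fun v : ℝ => ppMidKernelS β Λ κ lo e v) := by
  unfold ppMidKernelS
  exact (contDiff_ppTrueKernel_u hβ hΛ e).mul ((contDiff_const.sub ((hκ.of_le (by exact_mod_cast le_top)).comp (contDiff_ppSmoothRatio hlo e))).sub
    ((hκ.of_le (by exact_mod_cast le_top)).comp (contDiff_const.sub (contDiff_ppSmoothRatio hlo e))))

/-- **The far piece in a radius**: kernel rows `A·ρ^{−(i+1)}` at `(e,u)` (`i ≤ k`) and `1/(m̃ₑ+m̃ᵤ) ≤ 1/ρ` give
`∀ j ≤ k, |∂ᵤʲ A_s(e,·)(u)| ≤ 2ᵏ·A·B_κ·ρ^{−(j+1)}`. [cite: BenfattoGiulianiMastropietro2006, §2.4 (2.36)] -/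
theorem ppFarKernelS_jets_le_of_radius {β Λ : ℝ} (hβ : 0 < β) (hΛ : 0 < Λ) {lo : ℝ} (hlo : 0 < lo) {κ : ℝ → ℝ} (hκ : ContDiff ℝ (⊤ : ℕ∞) κ)
    {t₁ : ℝ} (ht₀ : 0 < t₁) (ht23 : t₁ ≤ 2 / 3) (h1 : ∀ t, t ≤ t₁ / 2 → κ t = 1) (h0 : ∀ t, t₁ ≤ t → κ t = 0) {k : ℕ} {Xκ : ℝ}
    (hXκ : ∀ i ≤ k, ∀ t : ℝ, |iteratedDeriv i κ t| ≤ Xκ) {e u ρ A : ℝ} (hρ : 0 < ρ) (hA0 : 0 ≤ A)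
    (hρ2 : 1 / (ppSmoothScale lo e + ppSmoothScale lo u) ≤ 1 / ρ)
    (hP : ∀ i ≤ k, |iteratedDeriv i (fun v : ℝ => ppTrueKernel β Λ e v) u| ≤ A * (1 / ρ) ^ (i + 1)) :
    ∀ j ≤ k, |iteratedDeriv j (fun v : ℝ => ppFarKernelS β Λ κ lo e v) u| ≤
      2 ^ k * A * (k ! * Xκ * (((k ! : ℝ)) ^ 2 * (4 / t₁)) ^ k) * (1 / ρ) ^ (j + 1) := by
  intro j hj
  have hX0 : 0 ≤ Xκ := (abs_nonneg _).trans (hXκ 0 (Nat.zero_le _) 0)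
  have hrows := comp_ppSmoothRatio_rows_of_radius hlo hκ ht₀ ht23 h1 h0 hXκ hρ2
  have h := abs_iteratedDeriv_mul_le_of_rows (k := j) (contDiff_ppTrueKernel_u hβ hΛ e)
    ((hκ.of_le (by exact_mod_cast le_top)).comp (contDiff_ppSmoothRatio hlo e)) u hρ
    (fun i hi => hP i (hi.trans hj)) (fun i hi => hrows i (hi.trans hj))
  unfold ppFarKernelS
  refine h.trans ?_
  have h2 : (2 : ℝ) ^ j ≤ 2 ^ k := pow_le_pow_right₀ (by norm_num) hj
  gcongr

/-- **The comparable-levels piece in a radius**: `∀ j ≤ k, |∂ᵤʲ M_s(e,·)(u)| ≤ 2ᵏ·A·(1 + 2B_κ)·ρ^{−(j+1)}`. [cite: BenfattoGiulianiMastropietro2006, §2.4 (2.36)] -/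
theorem ppMidKernelS_jets_le_of_radius {β Λ : ℝ} (hβ : 0 < β) (hΛ : 0 < Λ) {lo : ℝ} (hlo : 0 < lo) {κ : ℝ → ℝ} (hκ : ContDiff ℝ (⊤ : ℕ∞) κ)
    {t₁ : ℝ} (ht₀ : 0 < t₁) (ht23 : t₁ ≤ 2 / 3) (h1 : ∀ t, t ≤ t₁ / 2 → κ t = 1) (h0 : ∀ t, t₁ ≤ t → κ t = 0) {k : ℕ} {Xκ : ℝ}
    (hXκ : ∀ i ≤ k, ∀ t : ℝ, |iteratedDeriv i κ t| ≤ Xκ) {e u ρ A : ℝ} (hρ : 0 < ρ) (hA0 : 0 ≤ A)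
    (hρ2 : 1 / (ppSmoothScale lo e + ppSmoothScale lo u) ≤ 1 / ρ)
    (hP : ∀ i ≤ k, |iteratedDeriv i (fun v : ℝ => ppTrueKernel β Λ e v) u| ≤ A * (1 / ρ) ^ (i + 1)) :
    ∀ j ≤ k, |iteratedDeriv j (fun v : ℝ => ppMidKernelS β Λ κ lo e v) u| ≤
      2 ^ k * A * (1 + 2 * (k ! * Xκ * (((k ! : ℝ)) ^ 2 * (4 / t₁)) ^ k)) * (1 / ρ) ^ (j + 1) := by
  intro j hj
  have hX0 : 0 ≤ Xκ := (abs_nonneg _).trans (hXκ 0 (Nat.zero_le _) 0)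
  have hrows := midFactor_rows_of_radius hlo hκ ht₀ ht23 h1 h0 hXκ hρ hρ2
  have h := abs_iteratedDeriv_mul_le_of_rows (k := j) (contDiff_ppTrueKernel_u hβ hΛ e)
    ((contDiff_const.sub ((hκ.of_le (by exact_mod_cast le_top)).comp (contDiff_ppSmoothRatio hlo e))).sub
      ((hκ.of_le (by exact_mod_cast le_top)).comp (contDiff_const.sub (contDiff_ppSmoothRatio hlo e)))) u hρ
    (fun i hi => hP i (hi.trans hj)) (fun i hi => hrows i (hi.trans hj))
  unfold ppMidKernelS
  refine h.trans ?_
  have h2 : (2 : ℝ) ^ j ≤ 2 ^ k := pow_le_pow_right₀ (by norm_num) hj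
  gcongr

/-! ## §4 The rows in the law currency -/

/-- The kernel rows of `P` in a currency radius `max m |u|` with the order-uniform constant `A = (k+1)!·2^{2k+2}·(1+X)·K^{k+1}` (`0 < m ≤ K·Λ`, `1 ≤ K`).
[cite: BenfattoGiulianiMastropietro2006, §2.4 (2.36)] -/
theorem ppTrueKernel_rows_of_radius {β Λ : ℝ} (hβ : 0 < β) (hΛ : 0 < Λ) {k : ℕ} {X : ℝ} (hX : ∀ l ≤ k, ∀ x : ℝ, ‖iteratedFDeriv ℝ l salmhoferCutoff x‖ ≤ X)
    {K : ℝ} (hK : 1 ≤ K) {m : ℝ} (hm : 0 < m) (hmK : m ≤ K * Λ) (e u : ℝ) :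
    ∀ i ≤ k, |iteratedDeriv i (fun v : ℝ => ppTrueKernel β Λ e v) u| ≤ ((k + 1)! * 2 ^ (2 * k + 2) * (1 + X) * K ^ (k + 1)) * (1 / max m |u|) ^ (i + 1) := by
  intro i hi
  have hX0 : 0 ≤ X := zero_le_one.trans (one_le_of_cutoff_jets hX)
  refine (abs_iteratedDeriv_ppTrueKernel_le_of_floor hβ hΛ (fun l hl x => hX l (hl.trans hi) x) hm hK hmK e u).trans ?_
  exact mul_le_mul_of_nonneg_right (headlineConst_mono hi hX0 hK) (by positivity)

/-- The two currency radii are dominated by the smooth-floor sum: `1/(m̃ₑ+m̃ᵤ) ≤ 1/max |e| |u|` (`e ≠ 0`) and `≤ 1/max lo |u|`. [folklore] -/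
theorem inv_ppSmoothScale_add_le_currency {lo : ℝ} (hlo : 0 < lo) (e u : ℝ) :
    (e ≠ 0 → 1 / (ppSmoothScale lo e + ppSmoothScale lo u) ≤ 1 / max |e| |u|) ∧ 1 / (ppSmoothScale lo e + ppSmoothScale lo u) ≤ 1 / max lo |u| := by
  have h := inv_ppSmoothScale_add_pow_le hlo e u 1
  simp only [pow_one, one_div] at h ⊢
  exact h

/-- **THE ORDER-`k` ROWS OF THE FAR PIECE `A_s/C` IN THE LAW CURRENCY** (strip `0 < lo ≤ Λ`, box `hi ≤ K·Λ`, `1 ≤ K`,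
`C ≥ 2ᵏ·(k+1)!·2^{2k+2}·(1+X)·K^{k+1}·B_κ`, `B_κ = k!·X_κ·((k!)²·4/t₁)ᵏ`): `C^k` in `u` ∧ `∀ j ≤ k` joint continuity of `∂ᵤʲ(A_s/C)` ∧
`|∂ᵤʲ(A_s/C)(e,u)| ≤ (max |e| |u|)⁻¹^(j+1)` on the box (`e ≠ 0`) ∧ `≤ (max lo |u|)⁻¹^(j+1)` on the strip. [cite: BenfattoGiulianiMastropietro2006, §2.4 (2.36)] -/
theorem ppFarKernelS_orderRows {β Λ : ℝ} (hβ : 0 < β) (hΛ : 0 < Λ) {lo : ℝ} (hlo : 0 < lo) {κ : ℝ → ℝ} (hκ : ContDiff ℝ (⊤ : ℕ∞) κ)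
    {t₁ : ℝ} (ht₀ : 0 < t₁) (ht23 : t₁ ≤ 2 / 3) (h1 : ∀ t, t ≤ t₁ / 2 → κ t = 1) (h0 : ∀ t, t₁ ≤ t → κ t = 0) {k : ℕ} {X Xκ : ℝ}
    (hX : ∀ l ≤ k, ∀ x : ℝ, ‖iteratedFDeriv ℝ l salmhoferCutoff x‖ ≤ X) (hXκ : ∀ i ≤ k, ∀ t : ℝ, |iteratedDeriv i κ t| ≤ Xκ)
    {hi K C : ℝ} (hloΛ : lo ≤ Λ) (hK : 1 ≤ K) (hhiK : hi ≤ K * Λ) (hC : 0 < C)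
    (hCk : 2 ^ k * ((k + 1)! * 2 ^ (2 * k + 2) * (1 + X) * K ^ (k + 1)) * (k ! * Xκ * (((k ! : ℝ)) ^ 2 * (4 / t₁)) ^ k) ≤ C) :
    (∀ e : ℝ, ContDiff ℝ k (fun v : ℝ => ppFarKernelS β Λ κ lo e v / C)) ∧
      (∀ j ≤ k, Continuous fun p : ℝ × ℝ => iteratedDeriv j (fun v : ℝ => ppFarKernelS β Λ κ lo p.1 v / C) p.2) ∧
      (∀ j ≤ k, ∀ e ∈ Icc (-hi) hi, e ≠ 0 → ∀ u : ℝ, |iteratedDeriv j (fun v : ℝ => ppFarKernelS β Λ κ lo e v / C) u| ≤ (max |e| |u|)⁻¹ ^ (j + 1)) ∧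
      (∀ j ≤ k, ∀ e ∈ Icc (-lo) lo, ∀ u : ℝ, |iteratedDeriv j (fun v : ℝ => ppFarKernelS β Λ κ lo e v / C) u| ≤ (max lo |u|)⁻¹ ^ (j + 1)) := by
  have hX0 : 0 ≤ X := zero_le_one.trans (one_le_of_cutoff_jets hX)
  have hA0 : 0 ≤ ((k + 1)! : ℝ) * 2 ^ (2 * k + 2) * (1 + X) * K ^ (k + 1) := by positivity
  -- the row in a radius `ρ = max m |u|`, divided by `C`
  have hrow : ∀ j ≤ k, ∀ {m : ℝ}, 0 < m → m ≤ K * Λ → ∀ e u : ℝ, 1 / (ppSmoothScale lo e + ppSmoothScale lo u) ≤ 1 / max m |u| →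
      |iteratedDeriv j (fun v : ℝ => ppFarKernelS β Λ κ lo e v / C) u| ≤ (max m |u|)⁻¹ ^ (j + 1) := by
    intro j hj m hm hmK e u hρ2
    have hρ : 0 < max m |u| := lt_max_of_lt_left hm
    rw [iteratedDeriv_div_const, abs_div, abs_of_pos hC, div_le_iff₀ hC, ← one_div]
    refine (ppFarKernelS_jets_le_of_radius hβ hΛ hlo hκ ht₀ ht23 h1 h0 hXκ hρ hA0 hρ2 (ppTrueKernel_rows_of_radius hβ hΛ hX hK hm hmK e u) j hj).trans ?_
    rw [mul_comm]
    exact mul_le_mul_of_nonneg_left hCk (by positivity)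
  refine ⟨fun e => (contDiff_ppFarKernelS_u' hβ hΛ hlo hκ e).div_const C, fun j hj => ?_, fun j hj e he hne u => ?_, fun j hj e he u => ?_⟩
  · -- joint continuity: Leibniz sum of jointly continuous terms
    have hfun : (fun p : ℝ × ℝ => iteratedDeriv j (fun v : ℝ => ppFarKernelS β Λ κ lo p.1 v / C) p.2) = fun p : ℝ × ℝ =>
        (∑ i ∈ Finset.range (j + 1), (j.choose i : ℝ) * iteratedDeriv i (fun v : ℝ => ppTrueKernel β Λ p.1 v) p.2 *
          iteratedDeriv (j - i) (fun v : ℝ => κ (ppSmoothRatio lo p.1 v)) p.2) / C := by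
      funext p
      rw [iteratedDeriv_div_const]
      congr 1
      have hf : ContDiffAt ℝ j (fun v : ℝ => ppTrueKernel β Λ p.1 v) p.2 := (contDiff_ppTrueKernel_u hβ hΛ p.1).contDiffAt
      have hg : ContDiffAt ℝ j (fun v : ℝ => κ (ppSmoothRatio lo p.1 v)) p.2 :=
        ((hκ.of_le (by exact_mod_cast le_top)).comp (contDiff_ppSmoothRatio hlo p.1)).contDiffAt
      exact iteratedDeriv_fun_mul hf hg
    rw [hfun]
    refine Continuous.div_const (continuous_finsetSum _ fun i hi' => ?_) C
    have him : i ≤ j := Nat.lt_succ_iff.1 (Finset.mem_range.1 hi')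
    exact (continuous_const.mul (continuous_iteratedDeriv_ppTrueKernel₂ hβ hΛ fun l hl x => hX l (hl.trans (him.trans hj)) x)).mul
      (continuous_iteratedDeriv_slice₂ (contDiff_comp_ppSmoothRatio₂ hlo hκ) (j - i))
  · have hehi : |e| ≤ hi := abs_le.2 ⟨he.1, he.2⟩
    exact hrow j hj (abs_pos.2 hne) (hehi.trans hhiK) e u ((inv_ppSmoothScale_add_le_currency hlo e u).1 hne)
  · have hloK : lo ≤ K * Λ := hloΛ.trans (by nlinarith)
    exact hrow j hj hlo hloK e u (inv_ppSmoothScale_add_le_currency hlo e u).2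

/-- **THE ORDER-`k` ROWS OF THE COMPARABLE-LEVELS PIECE `M_s/C` IN THE LAW CURRENCY** (`C ≥ 2ᵏ·(k+1)!·2^{2k+2}·(1+X)·K^{k+1}·(1 + 2B_κ)`).
[cite: BenfattoGiulianiMastropietro2006, §2.4 (2.36)] -/
theorem ppMidKernelS_orderRows {β Λ : ℝ} (hβ : 0 < β) (hΛ : 0 < Λ) {lo : ℝ} (hlo : 0 < lo) {κ : ℝ → ℝ} (hκ : ContDiff ℝ (⊤ : ℕ∞) κ)
    {t₁ : ℝ} (ht₀ : 0 < t₁) (ht23 : t₁ ≤ 2 / 3) (h1 : ∀ t, t ≤ t₁ / 2 → κ t = 1) (h0 : ∀ t, t₁ ≤ t → κ t = 0) {k : ℕ} {X Xκ : ℝ}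
    (hX : ∀ l ≤ k, ∀ x : ℝ, ‖iteratedFDeriv ℝ l salmhoferCutoff x‖ ≤ X) (hXκ : ∀ i ≤ k, ∀ t : ℝ, |iteratedDeriv i κ t| ≤ Xκ)
    {hi K C : ℝ} (hloΛ : lo ≤ Λ) (hK : 1 ≤ K) (hhiK : hi ≤ K * Λ) (hC : 0 < C)
    (hCk : 2 ^ k * ((k + 1)! * 2 ^ (2 * k + 2) * (1 + X) * K ^ (k + 1)) * (1 + 2 * (k ! * Xκ * (((k ! : ℝ)) ^ 2 * (4 / t₁)) ^ k)) ≤ C) :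
    (∀ e : ℝ, ContDiff ℝ k (fun v : ℝ => ppMidKernelS β Λ κ lo e v / C)) ∧
      (∀ j ≤ k, Continuous fun p : ℝ × ℝ => iteratedDeriv j (fun v : ℝ => ppMidKernelS β Λ κ lo p.1 v / C) p.2) ∧
      (∀ j ≤ k, ∀ e ∈ Icc (-hi) hi, e ≠ 0 → ∀ u : ℝ, |iteratedDeriv j (fun v : ℝ => ppMidKernelS β Λ κ lo e v / C) u| ≤ (max |e| |u|)⁻¹ ^ (j + 1)) ∧
      (∀ j ≤ k, ∀ e ∈ Icc (-lo) lo, ∀ u : ℝ, |iteratedDeriv j (fun v : ℝ => ppMidKernelS β Λ κ lo e v / C) u| ≤ (max lo |u|)⁻¹ ^ (j + 1)) := by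
  have hX0 : 0 ≤ X := zero_le_one.trans (one_le_of_cutoff_jets hX)
  have hA0 : 0 ≤ ((k + 1)! : ℝ) * 2 ^ (2 * k + 2) * (1 + X) * K ^ (k + 1) := by positivity
  have hrow : ∀ j ≤ k, ∀ {m : ℝ}, 0 < m → m ≤ K * Λ → ∀ e u : ℝ, 1 / (ppSmoothScale lo e + ppSmoothScale lo u) ≤ 1 / max m |u| →
      |iteratedDeriv j (fun v : ℝ => ppMidKernelS β Λ κ lo e v / C) u| ≤ (max m |u|)⁻¹ ^ (j + 1) := by
    intro j hj m hm hmK e u hρ2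
    have hρ : 0 < max m |u| := lt_max_of_lt_left hm
    rw [iteratedDeriv_div_const, abs_div, abs_of_pos hC, div_le_iff₀ hC, ← one_div]
    refine (ppMidKernelS_jets_le_of_radius hβ hΛ hlo hκ ht₀ ht23 h1 h0 hXκ hρ hA0 hρ2 (ppTrueKernel_rows_of_radius hβ hΛ hX hK hm hmK e u) j hj).trans ?_
    rw [mul_comm]
    exact mul_le_mul_of_nonneg_left hCk (by positivity)
  refine ⟨fun e => (contDiff_ppMidKernelS_u' hβ hΛ hlo hκ e).div_const C, fun j hj => ?_, fun j hj e he hne u => ?_, fun j hj e he u => ?_⟩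
  · have hfun : (fun p : ℝ × ℝ => iteratedDeriv j (fun v : ℝ => ppMidKernelS β Λ κ lo p.1 v / C) p.2) = fun p : ℝ × ℝ =>
        (∑ i ∈ Finset.range (j + 1), (j.choose i : ℝ) * iteratedDeriv i (fun v : ℝ => ppTrueKernel β Λ p.1 v) p.2 *
          iteratedDeriv (j - i) (fun v : ℝ => 1 - κ (ppSmoothRatio lo p.1 v) - κ (1 - ppSmoothRatio lo p.1 v)) p.2) / C := by
      funext p
      rw [iteratedDeriv_div_const]
      congr 1
      have hf : ContDiffAt ℝ j (fun v : ℝ => ppTrueKernel β Λ p.1 v) p.2 := (contDiff_ppTrueKernel_u hβ hΛ p.1).contDiffAt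
      have hg : ContDiffAt ℝ j (fun v : ℝ => 1 - κ (ppSmoothRatio lo p.1 v) - κ (1 - ppSmoothRatio lo p.1 v)) p.2 :=
        ((contDiff_const.sub ((hκ.of_le (by exact_mod_cast le_top)).comp (contDiff_ppSmoothRatio hlo p.1))).sub
          ((hκ.of_le (by exact_mod_cast le_top)).comp (contDiff_const.sub (contDiff_ppSmoothRatio hlo p.1)))).contDiffAt
      exact iteratedDeriv_fun_mul hf hg
    rw [hfun]
    refine Continuous.div_const (continuous_finsetSum _ fun i hi' => ?_) C
    have him : i ≤ j := Nat.lt_succ_iff.1 (Finset.mem_range.1 hi')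
    exact (continuous_const.mul (continuous_iteratedDeriv_ppTrueKernel₂ hβ hΛ fun l hl x => hX l (hl.trans (him.trans hj)) x)).mul
      (continuous_iteratedDeriv_slice₂ (contDiff_midFactor₂ hlo hκ) (j - i))
  · have hehi : |e| ≤ hi := abs_le.2 ⟨he.1, he.2⟩
    exact hrow j hj (abs_pos.2 hne) (hehi.trans hhiK) e u ((inv_ppSmoothScale_add_le_currency hlo e u).1 hne)
  · have hloK : lo ≤ K * Λ := hloΛ.trans (by nlinarith)
    exact hrow j hj hlo hloK e u (inv_ppSmoothScale_add_le_currency hlo e u).2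

end Summit.HubbardSuperconductivity.HubbardSuperconductivity.Theorems.C4a

end
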